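import Summits.CriticalPhenomena.PercolationContinuityZ3.Theorems.PercNearOneGluingNoHeavyQuantTwinMove
import Summits.CriticalPhenomena.PercolationContinuityZ3.Theorems.PercNearOneGluingNoHeavyQuantFlowTransfer
import HarnessLib

/-!
# QUANT lane R8, T-DEC, leg (III): THE TWIN MOVE TRANSFER FACTS — the transferred routing of `P`'s nonzero lows obtained from a flow of `Λ`,
# as a flow witness of `P` with the zero removed, with the SHARP mid-column bound (the zero's and the blob atom's vacated capacity exhibited)

builds on p205010 (kernel theorem, internal audit signed; external expert review pending)

Support file (`--supports stmt-CriticalPhenomena-4575`), QUANT lane seat prim-quant-arm-1 (gen 39), rung R8 of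
`run/shared/lean/prim/quant/LADDER.md`.  Theorems only (no definitions), standard axioms, no sorries.  Factored out of this seat's
`…QuantTwinMoveBlobGiant` for the two-pour competitor (memo TWIN-MOVE-G39 §9–§10): TwinMove data (`P = zδ₀ + (1−z)R` at `t`, `Λ = z{0,a;g} + (1−z)R`
at `τ = t + zag`, `2a < t`, `a ≤ j`), a flow witness `f` of `Λ` at `(y, τ, j, N)`; the transfer `φ l h = [1 ≤ l, 2l < t]·(P l/Λ l)·f l h`
(`…QuantFlowTransfer`).  CONCLUSIONS: (i) `φ` is a flow witness of `P⁰ = [h ≠ 0]·P` at `(y, t, j, N)` (a routing of the nonzero lows within capacity);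
(ii) for every non-giant `h`: `load_t(φ, h) + usage_τ(0,h)·f 0 h + (1 − P a/Λ a)·usage_τ(a,h)·f a h ≤ load_τ(f, h)` — the zero's slots and the
fraction `zg/Λ a` of the blob atom's slots are VACATED; (iii) `load_τ(f, h) ≤ Λ h = P h` at every absorber `h ∉ {0, a}` of `P`; (iv) on the giants
`φ l g ≤ f l g` for `l ≠ a` and `φ a g = (P a/Λ a)·f a g`, `φ 0 g = 0`.

* **`LawDec.twinMove_transferFacts`**.

[this work]; nothing here is cited as a published result.  The gluing rows served [cite: KozmaNitzan2024, Conjecture 3 (p. 15)]; product measure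
[cite: Grimmett1999, §1.3 p. 10].
-/

noncomputable section

namespace Summit.CriticalPhenomena.PercolationContinuityZ3.Theorems

namespace Quant

open Finset

/-- the two-point law `{lo, hi; g}` (as in `…QuantLawDEC`) -/
local notation3 "TP[" lo ", " hi ", " g ", " h "]" =>
  (g : ℝ) * (if (h : ℕ) = (hi : ℕ) then (1 : ℝ) else 0) + (1 - (g : ℝ)) * (if (h : ℕ) = (lo : ℕ) then (1 : ℝ) else 0)

namespace LawDec

/-- **THE TWIN MOVE TRANSFER FACTS.**  See the module docstring. [this work] -/
theorem twinMove_transferFacts (y z g : ℝ) (a j N : ℕ) (R : ℕ → ℝ) (f : ℕ → ℕ → ℝ)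
    (hy0 : 0 < y) (hy1 : y < 1) (hz0 : 0 ≤ z) (hz1 : z < 1) (hg0 : 0 < g) (hg1 : g ≤ 1) (ha1 : 1 ≤ a)
    (hR0 : ∀ h, 0 ≤ R h)
    (hat : 2 * (a : ℝ) < (1 - z) * ∑ h ∈ Finset.range (N + 1), (h : ℝ) * R h) (haj : a ≤ j)
    (hf : IsFlowAtT y (z * (a : ℝ) * g + (1 - z) * ∑ h ∈ Finset.range (N + 1), (h : ℝ) * R h) j N
      (fun h => z * TP[0, a, g, h] + (1 - z) * R h) f) :
    let t : ℝ := (1 - z) * ∑ h ∈ Finset.range (N + 1), (h : ℝ) * R h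
    let τ : ℝ := z * (a : ℝ) * g + (1 - z) * ∑ h ∈ Finset.range (N + 1), (h : ℝ) * R h
    let Λ : ℕ → ℝ := fun h => z * TP[0, a, g, h] + (1 - z) * R h
    let P : ℕ → ℝ := fun h => z * (if h = 0 then (1 : ℝ) else 0) + (1 - z) * R h
    let φ : ℕ → ℕ → ℝ := fun l h => if (1 ≤ l ∧ 2 * (l : ℝ) < t) then P l / Λ l * f l h else 0
    IsFlowAtT y t j N (fun h => if h = 0 then 0 else P h) φ ∧
    (∀ h, ¬ (j + 1 ≤ h) → ∑ l ∈ Finset.range (j + 1), usage y t j l h * φ l h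
        + usage y τ j 0 h * f 0 h + (1 - P a / Λ a) * (usage y τ j a h * f a h)
      ≤ ∑ l ∈ Finset.range (j + 1), usage y τ j l h * f l h) ∧
    (∀ h, h ≤ N → (j + 1 ≤ h ∨ t ≤ 2 * (h : ℝ)) → ∑ l ∈ Finset.range (j + 1), usage y τ j l h * f l h ≤ Λ h ∧ Λ h = P h) ∧
    (∀ l g', j + 1 ≤ g' → l ≠ a → φ l g' ≤ f l g') ∧ (∀ g', φ a g' = P a / Λ a * f a g') ∧ (∀ h, φ 0 h = 0) ∧
    (0 ≤ P a / Λ a ∧ P a / Λ a ≤ 1 ∧ P a = Λ a - z * g) := by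
  intro t τ Λ P φ
  classical
  have h1z : 0 < 1 - z := by linarith
  have ha0 : (0 : ℝ) ≤ a := Nat.cast_nonneg a
  have hane : a ≠ 0 := by omega
  have hzg : 0 ≤ z * g := mul_nonneg hz0 hg0.le
  have hzag : 0 ≤ z * (a : ℝ) * g := mul_nonneg (mul_nonneg hz0 ha0) hg0.le
  have htτ : t ≤ τ := by show (1 - z) * _ ≤ z * (a : ℝ) * g + (1 - z) * _; linarith
  have ht0 : 0 < t := by show 0 < (1 - z) * _; nlinarith
  -- values
  have hP0 : ∀ h, 0 ≤ P h := fun h => by show 0 ≤ z * _ + (1 - z) * R h; split_ifs <;> nlinarith [hR0 h]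
  have hΛa : Λ a = z * g + (1 - z) * R a := by
    show z * (g * (if a = a then (1:ℝ) else 0) + (1 - g) * (if a = 0 then (1:ℝ) else 0)) + (1 - z) * R a = _
    rw [if_pos rfl, if_neg hane]; ring
  have hPa : P a = (1 - z) * R a := by
    show z * (if a = 0 then (1:ℝ) else 0) + (1 - z) * R a = _
    rw [if_neg hane]; ring
  have hΛP : ∀ h, h ≠ 0 → h ≠ a → Λ h = P h := by
    intro h h0 ha
    show z * (g * (if h = a then (1:ℝ) else 0) + (1 - g) * (if h = 0 then (1:ℝ) else 0)) + (1 - z) * R h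
      = z * (if h = 0 then (1:ℝ) else 0) + (1 - z) * R h
    rw [if_neg h0, if_neg ha]; ring
  have hΛnn : ∀ h, 0 ≤ Λ h := fun h => by
    show 0 ≤ z * (g * (if h = a then (1:ℝ) else 0) + (1 - g) * (if h = 0 then (1:ℝ) else 0)) + (1 - z) * R h
    split_ifs <;> nlinarith [hR0 h, mul_nonneg hz0 (sub_nonneg.2 hg1)]
  have hPΛa : P a = Λ a - z * g := by rw [hPa, hΛa]; ring
  have hθ : 0 ≤ P a / Λ a ∧ P a / Λ a ≤ 1 := by
    rcases (hΛnn a).eq_or_lt with hz | hp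
    · have : P a = 0 := by nlinarith [hP0 a, hPΛa, hzg]
      rw [this, zero_div]; exact ⟨le_rfl, zero_le_one⟩
    · exact ⟨div_nonneg (hP0 a) hp.le, (div_le_one hp).2 (by linarith)⟩
  obtain ⟨hf0, hfsupp, hfrow, hfcol⟩ := id hf
  -- rows shrink
  have hrows : ∀ l : ℕ, 1 ≤ l → l ≤ j → 2 * (l : ℝ) < t → 0 ≤ P l ∧ P l ≤ Λ l := by
    intro l h1 _ _
    refine ⟨hP0 l, ?_⟩
    by_cases hla : l = a
    · rw [hla, hPΛa]; linarith
    · rw [hΛP l (by omega) hla]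
  obtain ⟨hφ0, hφsupp, hφrow, _⟩ := transfer_partialRouting y t τ j N Λ P f hy0 hy1 htτ hf hrows
  have hφzero : ∀ h, φ 0 h = 0 := fun h => by show (if (1 ≤ 0 ∧ _) then _ else (0:ℝ)) = 0; rw [if_neg (by omega)]
  -- facts about charged pairs of `f`
  have hpair : ∀ l h, 0 < f l h → l ≤ j ∧ 2 * (l : ℝ) < τ ∧ h ≤ N ∧ (j + 1 ≤ h ∨ τ < (l : ℝ) + h) ∧ l < h := by
    intro l h hp
    obtain ⟨hlj, hl2, hhM, hc⟩ := hfsupp l h hp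
    refine ⟨hlj, hl2, hhM, hc, ?_⟩
    rcases hc with hc | hc
    · omega
    · have : (l : ℝ) < h := by linarith
      exact_mod_cast this
  have huτ0 : ∀ l h, 0 ≤ usage y τ j l h * f l h := by
    intro l h
    rcases (hf0 l h).eq_or_lt with hz | hp
    · rw [← hz, mul_zero]
    · obtain ⟨_, hl2, _, hc, hlh⟩ := hpair l h hp
      exact mul_nonneg (usage_pos_of_compat y τ j l h hy0 hy1 hl2 hlh hc).le hp.le
  -- the sharp termwise comparison: `usage_t·φ l h ≤ (P l/Λ l)·usage_τ·f l h` on the guard, `0` off it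
  have hsharp : ∀ l h, 1 ≤ l → usage y t j l h * φ l h ≤ P l / Λ l * (usage y τ j l h * f l h) := by
    intro l h h1
    show usage y t j l h * (if (1 ≤ l ∧ 2 * (l : ℝ) < t) then P l / Λ l * f l h else 0) ≤ _
    have hθl : 0 ≤ P l / Λ l := div_nonneg (hP0 l) (hΛnn l)
    by_cases hc : (1 ≤ l ∧ 2 * (l : ℝ) < t)
    · rw [if_pos hc]
      rcases (hf0 l h).eq_or_lt with hz | hfp
      · rw [← hz, mul_zero, mul_zero, mul_zero, mul_zero]
      · obtain ⟨hlj, hl2, _, hcomp, hlh⟩ := hpair l h hfp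
        have hcompt : j + 1 ≤ h ∨ t < (l : ℝ) + h := by
          rcases hcomp with h1' | h2
          · exact Or.inl h1'
          · exact Or.inr (lt_of_le_of_lt htτ h2)
        have hmono : usage y t j l h ≤ usage y τ j l h := by
          by_cases hg : j + 1 ≤ h
          · rw [usage_giant_eq y t j l h hg, usage_giant_eq y τ j l h hg]
          · exact usage_le_of_rho_le y t τ j l l h hy0 hy1 (by omega) hl2 (hcomp.resolve_left hg)
              (rho_le_of_target_le t τ l h hlh htτ)
        calc usage y t j l h * (P l / Λ l * f l h) = P l / Λ l * (usage y t j l h * f l h) := by ring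
          _ ≤ P l / Λ l * (usage y τ j l h * f l h) :=
              mul_le_mul_of_nonneg_left (mul_le_mul_of_nonneg_right hmono hfp.le) hθl
    · rw [if_neg hc, mul_zero]; exact mul_nonneg hθl (huτ0 l h)
  have hterm : ∀ l h, usage y t j l h * φ l h ≤ usage y τ j l h * f l h := by
    intro l h
    by_cases h1 : 1 ≤ l
    · refine (hsharp l h h1).trans ?_
      have hθl1 : P l / Λ l ≤ 1 := by
        by_cases hla : l = a
        · rw [hla]; exact hθ.2
        · rw [hΛP l (by omega) hla]
          rcases (hP0 l).eq_or_lt with hz | hp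
          · rw [← hz, div_zero]; exact zero_le_one
          · rw [div_self hp.ne']
      calc P l / Λ l * (usage y τ j l h * f l h) ≤ 1 * (usage y τ j l h * f l h) :=
            mul_le_mul_of_nonneg_right hθl1 (huτ0 l h)
        _ = _ := one_mul _
    · have : l = 0 := by omega
      rw [this, hφzero, mul_zero]; exact huτ0 0 h
  -- `Λ`'s column bound at every `t`-absorber, and `Λ = P` there
  have hcolΛ : ∀ h, h ≤ N → (j + 1 ≤ h ∨ t ≤ 2 * (h : ℝ)) →
      ∑ l ∈ Finset.range (j + 1), usage y τ j l h * f l h ≤ Λ h ∧ Λ h = P h := by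
    intro h hhN habs
    have hh0 : h ≠ 0 := by
      rcases habs with h1 | h2
      · omega
      · intro he; rw [he] at h2; simp at h2; linarith
    have hha : h ≠ a := by
      rcases habs with h1 | h2
      · omega
      · intro he; rw [he] at h2
        have : 2 * (a : ℝ) < t := hat
        linarith
    refine ⟨?_, hΛP h hh0 hha⟩
    by_cases hτh : j + 1 ≤ h ∨ τ ≤ 2 * (h : ℝ)
    · exact hfcol h hhN hτh
    · obtain ⟨hτ1, hτ2⟩ := not_or.1 hτh
      have hτ2' : 2 * (h : ℝ) < τ := not_le.1 hτ2
      have : ∑ l ∈ Finset.range (j + 1), usage y τ j l h * f l h = 0 := Finset.sum_eq_zero fun l _ => by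
        rcases (hf0 l h).eq_or_lt with hz | hp
        · rw [← hz, mul_zero]
        · exfalso
          obtain ⟨_, hl2, _, hc, _⟩ := hpair l h hp
          rcases hc with hc | hc
          · exact hτ1 hc
          · linarith
      rw [this]; exact hΛnn h
  refine ⟨⟨hφ0, fun l h hp => ?_, fun l hlj hlow => ?_, fun h hhN habs => ?_⟩, fun h hg => ?_, hcolΛ,
    fun l g' hg' hla => ?_, fun g' => ?_, hφzero, hθ.1, hθ.2, hPΛa⟩
  · obtain ⟨hl, hhM, hc⟩ := hφsupp l h hp
    exact ⟨hl.2.1, hl.2.2, hhM, hc⟩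
  · show ∑ h ∈ Finset.range (N + 1), φ l h = (if l = 0 then 0 else P l)
    by_cases hl0 : l = 0
    · rw [hl0, if_pos rfl]; exact Finset.sum_eq_zero fun h _ => hφzero h
    · rw [if_neg hl0]; exact hφrow l (Nat.one_le_iff_ne_zero.2 hl0) hlj hlow
  · show ∑ l ∈ Finset.range (j + 1), usage y t j l h * φ l h ≤ (if h = 0 then 0 else P h)
    obtain ⟨hc, hΛPh⟩ := hcolΛ h hhN habs
    have hh0 : h ≠ 0 := by
      rcases habs with h1 | h2
      · omega
      · intro he; rw [he] at h2; simp at h2; linarith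
    rw [if_neg hh0, ← hΛPh]
    exact (Finset.sum_le_sum fun l _ => hterm l h).trans hc
  · -- the sharp mid-column bound: pull out the terms `l = 0` and `l = a`
    have h0mem : (0:ℕ) ∈ Finset.range (j + 1) := Finset.mem_range.2 (Nat.succ_pos j)
    have hamem : a ∈ (Finset.range (j + 1)).erase 0 := Finset.mem_erase.2 ⟨hane, Finset.mem_range.2 (by omega)⟩
    have eL : ∑ l ∈ Finset.range (j + 1), usage y t j l h * φ l h
        = usage y t j a h * φ a h + ∑ l ∈ ((Finset.range (j + 1)).erase 0).erase a, usage y t j l h * φ l h := by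
      rw [← Finset.add_sum_erase _ _ h0mem, hφzero, mul_zero, zero_add, ← Finset.add_sum_erase _ _ hamem]
    have eR : ∑ l ∈ Finset.range (j + 1), usage y τ j l h * f l h
        = usage y τ j 0 h * f 0 h + (usage y τ j a h * f a h + ∑ l ∈ ((Finset.range (j + 1)).erase 0).erase a, usage y τ j l h * f l h) := by
      rw [← Finset.add_sum_erase _ _ h0mem, ← Finset.add_sum_erase _ _ hamem]
    rw [eL, eR]
    have hrest : ∑ l ∈ ((Finset.range (j + 1)).erase 0).erase a, usage y t j l h * φ l h
        ≤ ∑ l ∈ ((Finset.range (j + 1)).erase 0).erase a, usage y τ j l h * f l h := Finset.sum_le_sum fun l _ => hterm l h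
    have ha' := hsharp a h ha1
    nlinarith [hrest, ha', huτ0 a h]
  · -- giants, `l ≠ a`
    show (if (1 ≤ l ∧ 2 * (l : ℝ) < t) then P l / Λ l * f l g' else 0) ≤ f l g'
    split_ifs with hc
    · by_cases hl0 : l = 0
      · exfalso; omega
      · rw [hΛP l hl0 hla]
        rcases (hP0 l).eq_or_lt with hz | hp
        · rw [← hz, zero_div, zero_mul]; exact hf0 l g'
        · rw [div_self hp.ne', one_mul]
    · exact hf0 l g'
  · -- the row of `a` is scaled (the guard holds: `1 ≤ a`, `2a < t`)
    show (if (1 ≤ a ∧ 2 * (a : ℝ) < t) then P a / Λ a * f a g' else 0) = P a / Λ a * f a g'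
    rw [if_pos ⟨ha1, hat⟩]

end LawDec

end Quant

end Summit.CriticalPhenomena.PercolationContinuityZ3.Theorems
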